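import Summits.BirchSwinnertonDyer.Rank1Residual.X5.TwoAdicTargetsMultLaw
import HarnessLib

/-!
# Class O1 (X5, `p = 2`, non-CM), NON-SPLIT MULTIPLICATIVE `2`, E[2] IRREDUCIBLE: Kato's divisibility
# WITH the 2-power part (T-KATO2-NSMULT) as a DISPLAYED hypothesis, the Selmer lower bound on `λ` as a
# DISPLAYED hypothesis, and door (34-INT-pinch) — `BSD₂(E)` with NO reference curve and NO `2`-torsion

HONEST FRAMING (cell `bsd-2adic`, run/shared/lean/pub/bsd-2adic/, seat `bsd-2adic-mult` GEN 6; HUMAN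
RULINGS D-0036 / D-0054): research route; nothing is asserted; no class is closed here; no count moves.
TWO displayed `def`s — `O1.KatoDivisibilityAtTwoNonsplitMultInt` (= the tree's G1
`O1.KatoDivisibilityAtTwoMultUpTo W 0 f (-1) L` in the `Ω⁺`-normalised form used by the memo:
THEOREM A of `HOME/mult/PROOF-KATO2MULT.md` v1, referee pending — Kato's divisibility
`char_Λ X(E/ℚ_∞) ∣ L₂(E,T)` in `Λ = ℤ₂⟦T⟧`, `2`-power part INCLUDED, for `ρ_{E,2^∞}` surjective and `E`
non-split multiplicative at `2` with `Δ_E < 0`, by transport of the reserve's W_K2 (Rubin's `Λ`-adic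
Euler-system theorem II.3.8 over `ℚ_∞`)) and `O1.SelmerLambdaLowerBoundAtTwo W n` (`n ≤ λ(X)` once
`μ(X) = 0`: Greenberg Prop. 4.14 at `2` — `E(ℚ)[2] = 0` ⇒ no finite submodule — + inflation–restriction +
the `2`-descent certificate `dim_{𝔽₂} Sel₂(E/ℚ) = n`; memo §6.2 Lemma P/Q) — and TWO PROVED doors:
`bsdp_two_nonsplit_of_katoIntPinch` (`BSDp W 2`, both halves) and the rank-`0` `2`-converse
`analyticRank_eq_zero_of_finite_selmer_of_katoIntPinch` — inputs PRINT {A235 `h41`, modularity, GZK} +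
MEMO {`hKint`, `hlow`} + CERTIFICATES {`hlan : λ_an = n`, `hμan : μ_an = 0`} (GEN-3 engine of record)
+ the period datum `hper₀ : 0 ≤ ord₂ ϖ` (a theorem on this locus — Česnavičius 2018 Thm. 1.2 — but
displayed, as in every door of the cell) and NOTHING ELSE: no reference curve, no rational `2`-torsion
point, no λ-law, no `μ`-hypothesis on `X`. This is
the first door on the E[2]-IRREDUCIBLE locus (1 680 of the 1 976 multiplicative-at-`2` residue classes;
CENSUS-6, kit j248824: 808 classes are non-split ∧ surjective ∧ `Δ < 0` ∧ `dim Sel₂ = 2`).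

PARTITION (D-0054): X5@2 mult, E[2]-irreducible (B1·O1; 1 062 surjective non-split of 1 976 book230
classes) × p = 2 — types-the-object-of (door); closes none.
References: [Kato2004Asterisque] 17.11–17.13, 16.6; [Rubin2000EulerSystems] Thm. II.3.8;
[GreenbergLNM1716] Prop. 4.14 (p. 124), §4 pp. 112–113; [GreenbergVatsal2000] p. 4;
[MazurTateTeitelbaum1986Invent] §I.14; [Miller2011LMS] Def. 1.1; [Cesnavicius2018] Thm. 1.2.
-/

set_option autoImplicit false

noncomputable section

open scoped Classical MatrixGroups ModularForm

open CongruenceSubgroup WeierstrassCurve Literature.NumberTheory.EllipticCurves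
  Literature.NumberTheory.EllipticCurves.ModularForms
  Literature.NumberTheory.EllipticCurves.Wuthrich2014
  Literature.NumberTheory.EllipticCurves.Rank1Residual
  Literature.NumberTheory.EllipticCurves.Rank1Residual.Typed
  Literature.NumberTheory.EllipticCurves.Greenberg1999
  Literature.NumberTheory.Transcendental
  Summit.BirchSwinnertonDyer.Rank1Residual.X1.MuLambda
  Summit.BirchSwinnertonDyer.Rank1Residual.X1.MuPart
  Summit.BirchSwinnertonDyer.Rank1Residual.X1.ParitySqueeze

namespace Summit.BirchSwinnertonDyer.Rank1Residual.X5.O1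

variable (W : WeierstrassCurve ℚ) [W.IsElliptic] [W.IsGloballyMinimal]

/-! ## §1 T-KATO2-NSMULT and the Selmer `λ`-lower-bound as DISPLAYED hypotheses (nothing asserted) -/

/-- **T-KATO2-NSMULT (DISPLAYED; memo-proved in `HOME/mult/PROOF-KATO2MULT.md` v1 Thm. A + §4.7,
referee pending; nothing asserted).** For `W` (globally minimal) NON-SPLIT multiplicative at `2` with
`ρ_{E,2^∞}(G_ℚ) = GL₂(ℤ₂)` (`TwoAdicSurjective`) and `Δ_W < 0` (one real component, so that the least
positive real period IS the BSD period): for every newform `f` of `W`, THE `2`-adic `L`-function `L` of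
`f` at the non-split prime (`α = −1`), every cyclotomic `ℤ₂`-extension with a matching generator, every
dual datum `D` of `Sel_{2^∞}(E/ℚ_∞)`, every period ratio `ϖ` (`ϖ·Ω_E = Ω⁺_f`) and every `L₀ ∈ Λ` with
`ι L₀ = ϖ·L`: `X` is torsion and `L₀ ∈ char_Λ X` — i.e. `char_Λ X ∣ L₀` in `Λ = ℤ₂⟦T⟧`, `2`-POWER PART
INCLUDED (the memo's Thm. A: `char X ∣ L₂^{Ω⁺_E}`; and `L₂^{Ω⁺_E} = ϖ·c_∞·L` with `c_∞ = 1` here and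
`ϖ ∈ ℤ₍₂₎ˣ` by Česnavičius 2018 Thm. 1.2 — `2 ∥ N ⇒` odd Manin constant — and odd isogenies, §4.7).
In print only `⊗ℚ` / for odd `p` (Kato Thm. 17.4 assumes `p ∤ N`; Skinner 2016 `p ≥ 3`; Rubin
Thm. III.5.16's integral clause needs `2 ∤ r_E·∏ℓ_q(q⁻¹)`); the good-ordinary-at-`2` twin is the
reserve's W_K2 (prior-2001 archive, refereed there). [cite: Kato2004Asterisque, Prop. 17.11–Lemma 17.12 and 17.13 (pp. 277–280), Thm. 16.6 (p. 271)]
[cite: GreenbergLNM1716, §4 pp. 112–113 (the non-split local term)] -/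
@[conjecture] def KatoDivisibilityAtTwoNonsplitMultInt : Prop :=
  Mult W 2 → ¬ W.HasSplitMultiplicativeReductionAtPrime 2 → TwoAdicSurjective W → W.Δ < 0 →
  ∀ ⦃N : ℕ⦄ [NeZero N] (f : CuspForm (Gamma0 N) 2), IsNewformOf W f →
  ∀ (L : PowerSeries ℚ_[2]), IsMultPAdicLFunctionOf f 2 (-1) L →
  ∀ (κ : ZpExtension ℚ 2) (γ : Field.absoluteGaloisGroup ℚ),
    κ.IsCyclotomic → κ.IsTopGenerator γ → IsCyclotomicVariable 2 γ →
  ∀ (D : W.SelmerDualData κ γ) (ϖ : ℚ), (ϖ : ℝ) * W.realPeriodRat = plusPeriod f →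
  ∀ (L₀ : IwasawaAlgebra 2), iwasawaToPowerSeries 2 L₀ = PowerSeries.C (ϖ : ℚ_[2]) * L →
    D.IsTorsion ∧ L₀ ∈ D.charIdeal

omit [W.IsElliptic] [W.IsGloballyMinimal] in
/-- Off the multiplicative locus the displayed statement holds VACUOUSLY (its guard). [folklore] -/
theorem katoDivisibilityAtTwoNonsplitMultInt_of_not_mult (h : ¬ Mult W 2) :
    KatoDivisibilityAtTwoNonsplitMultInt W :=
  fun hm => absurd hm h

/-- **The Selmer lower bound on `λ` at `2` (DISPLAYED; memo §6.2 Lemma P + Lemma Q + Greenberg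
Prop. 4.14; nothing asserted).** For `W` with `E[2]` irreducible (so `E(ℚ_∞)[2] = 0`): for every
cyclotomic dual datum `D` with `X` torsion and `μ(X) = 0`, `n ≤ λ(X)`, where `n` is the CERTIFIED
`𝔽₂`-dimension of `Sel₂(E/ℚ)` (2-descent): `X` has no non-zero finite `Λ`-submodule (Greenberg
Prop. 4.14, any `p`, hypothesis `E(ℚ)[p] = 0`), hence `X ≅ ℤ₂^{λ}` and `λ ≥ dim_{𝔽₂} X/(2,T)X =
dim_{𝔽₂} (Sel_{2^∞}(E/ℚ_∞)^Γ)[2] ≥ dim_{𝔽₂} Sel_{2^∞}(E/ℚ)[2] = dim_{𝔽₂} Sel₂(E/ℚ)`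
(restriction is injective as `E(ℚ_∞)[2] = 0`). [cite: GreenbergLNM1716, Prop. 4.14 (p. 124) and p. 161]
[cite: Kato2004Asterisque, Thm. 17.4 (1) (p. 273) (torsion, shape)] -/
@[conjecture] def SelmerLambdaLowerBoundAtTwo (n : ℕ) : Prop :=
  ∀ (κ : ZpExtension ℚ 2) (γ : Field.absoluteGaloisGroup ℚ),
    κ.IsCyclotomic → κ.IsTopGenerator γ → IsCyclotomicVariable 2 γ →
  ∀ (D : W.SelmerDualData κ γ), D.IsTorsion → D.mu = 0 → n ≤ D.lambda

/-! ## §2 The pinch from the INTEGRAL divisibility: `char_Λ X = (L₀)` (pure algebra) -/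

/-- **The `λ`-pinch from Kato WITH the `2`-power part (PROVED, pure algebra).** A cyclotomic dual
datum `D` with `X` torsion and `L₀ ∈ char_Λ X = (f_X)` (T-KATO2-NSMULT), certificates `μ(L₀) = 0`
(`hμan`) and `λ(L₀) = n` (`hlan`) for `ι L₀ = ϖ·L`, and the Selmer lower bound `n ≤ λ(X)` once
`μ(X) = 0` (`hlow`). Then `char_Λ X = (L₀)`: `L₀ = f_X·b` gives `μ(f_X) ≤ μ(L₀) = 0`, so `μ(X) = 0`,
so `λ(L₀) = n ≤ λ(X) = λ(f_X)`, and `span_eq_span_iff_mu_le_and_lam_le` closes. No `μ`-hypothesis on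
`X`, no reference curve, no rank input. [cite: GreenbergVatsal2000, p. 4 (after Thm. (1.2)) (λ_alg = λ_an and μ_alg = μ_an ⇒ main conjecture)]
[cite: Kato2004Asterisque, Thm. 17.4 (p. 273) (shape of the divisibility)] -/
theorem charIdeal_eq_span_of_katoInt_selmerPinch_nonsplit
    (hns : ¬ W.HasSplitMultiplicativeReductionAtPrime 2) {n : ℕ}
    (hlan : X2.AnalyticLambdaEq W 2 n) (hμan : X2.AnalyticMuLE W 2 0)
    {κ : ZpExtension ℚ 2} {γ : Field.absoluteGaloisGroup ℚ} (hκ : κ.IsCyclotomic)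
    (hγ : κ.IsTopGenerator γ) (hγ' : IsCyclotomicVariable 2 γ)
    {N : ℕ} [NeZero N] {f : CuspForm (Gamma0 N) 2} (hf : IsNewformOf W f) {L : PowerSeries ℚ_[2]}
    (hLf : IsMultPAdicLFunctionOf f 2 (-1) L) (D : W.SelmerDualData κ γ) (hX : D.IsTorsion)
    {ϖ : ℚ} (hϖ : (ϖ : ℝ) * W.realPeriodRat = plusPeriod f) {L₀ : IwasawaAlgebra 2}
    (hL₀ : iwasawaToPowerSeries 2 L₀ = PowerSeries.C (ϖ : ℚ_[2]) * L)
    (hKL₀ : L₀ ∈ D.charIdeal) (hlow : SelmerLambdaLowerBoundAtTwo W n) :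
    D.charIdeal = Ideal.span {L₀} := by
  haveI : Module.Finite (IwasawaAlgebra 2) D.X := D.module_finite_holds hγ
  obtain ⟨k, hk⟩ := hμan f hf ϖ hϖ L (fun hsp => absurd hsp hns) (fun _ => hLf)
  rw [← hL₀] at hk
  have hμL₀ : mu L₀ = 0 := Nat.le_zero.mp (mu_le_of_lt_norm_coeff hk)
  have hL₀0 : L₀ ≠ 0 := by
    rintro rfl
    rw [map_zero, map_zero, norm_zero] at hk
    exact not_le.mpr hk (by positivity)
  haveI : (Module.charIdeal (IwasawaAlgebra 2) D.X).IsPrincipal := charIdeal_isPrincipal_holds 2 D.X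
  obtain ⟨fX, hfX⟩ := Submodule.IsPrincipal.principal (Module.charIdeal (IwasawaAlgebra 2) D.X)
  have hchar : D.charIdeal = Ideal.span {fX} := hfX
  have hfX0 : fX ≠ 0 := by
    intro h0
    refine Module.charIdeal_ne_bot (IwasawaAlgebra 2) D.X ?_
    change D.charIdeal = ⊥
    rw [hchar, h0]
    exact Ideal.span_singleton_eq_bot.mpr rfl
  rw [hchar] at hKL₀
  obtain ⟨b, hb⟩ := Ideal.mem_span_singleton'.mp hKL₀
  have hfac : L₀ = fX * b := by rw [mul_comm, hb]
  have hb0 : b ≠ 0 := by rintro rfl; exact hL₀0 (by rw [hfac, mul_zero])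
  have hμfX : mu fX = 0 := by
    have h := mu_le_mu_mul hfX0 hb0
    rw [← hfac, hμL₀] at h
    exact Nat.le_zero.mp h
  have hμX : D.mu = 0 := by
    rw [SelmerDualData.mu, ← mu_generator_eq_muInvariant D.X hX hfX0 hchar]; exact hμfX
  have hlamfX : lam fX = D.lambda := lam_generator_eq_lambdaInvariant D.X hX hfX0 hchar
  have hlan' : lam L₀ = n := hlan f hf ϖ hϖ L (fun hsp => absurd hsp hns) (fun _ => hLf) L₀ hL₀
  have hle : n ≤ D.lambda := hlow κ γ hκ hγ hγ' D hX hμX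
  have hspan : Ideal.span ({L₀} : Set (IwasawaAlgebra 2)) = Ideal.span {fX} :=
    (span_eq_span_iff_mu_le_and_lam_le hfX0 hL₀0 hfac).mpr
      ⟨by rw [hμL₀]; exact Nat.zero_le _, by rw [hlan', hlamfX]; exact hle⟩
  rw [hchar, hspan]

/-! ## §3 Door (34-INT-pinch), NON-SPLIT `2`, E[2] irreducible: `BSD₂(E)` and the rank-`0` `2`-converse -/

/-- **DOOR (34-INT-pinch), non-split `E` with `E[2]` irreducible (PROVED modulo the displayed inputs):
`BSDp W 2`, both halves.** Binders: PRINT {A235 `h41`, modularity `hmod`, GZK}; MEMO {T-KATO2-NSMULT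
`hKint` (PROOF-KATO2MULT Thm. A), the Selmer `λ`-lower-bound `hlow` (ibid. §6.2 on Greenberg 4.14)};
CERTIFICATES {`λ_an(E) = n` (`hlan`), `μ_an(E) = 0` (`hμan`) — GEN-3 engine at level 6}; the curve's
own decidable data {`Mult W 2`, non-split, `TwoAdicSurjective W`, `Δ < 0`}; `hper₀`; analytic rank `0`.
No reference, no `2`-torsion point, no `μ`-input. Chain: `hKint` ⇒ `X` torsion ∧ `L₀ ∈ char X`;
`charIdeal_eq_span_of_katoInt_selmerPinch_nonsplit` ⇒ `char X = (L₀)`;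
`missingPPartAt_two_nonsplit_of_charIdeal_eq_span` (A235: the `l_v = 2` cancels MTT's `(1 − α⁻¹) = 2`)
⇒ `ord₂ #Ш_an = ord₂ #Ш`; `bsdp_of_missingPPartAt`. [cite: GreenbergLNM1716, §4 pp. 112–113 and Prop. 4.14 (p. 124)]
[cite: MazurTateTeitelbaum1986Invent, §I.14 (L(0) = (1 − α⁻¹)[0]⁺, α = −1)] [cite: Miller2011LMS, Def. 1.1 and §1] -/
theorem bsdp_two_nonsplit_of_katoIntPinch {n : ℕ}
    (h41 : thm41Analogue_charValue_rankZero_numberField_anyPrime)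
    (hmod : nonempty_modularParametrizationData)
    (hGZK : rank_eq_analyticRank_of_analyticRank_le_one)
    (hKint : KatoDivisibilityAtTwoNonsplitMultInt W) (hlow : SelmerLambdaLowerBoundAtTwo W n)
    (hper₀ : ∀ [NeZero (W.conductorNorm ℤ)] (f : CuspForm (Gamma0 (W.conductorNorm ℤ)) 2),
      IsNewformOf W f → ∀ ϖ : ℚ, (ϖ : ℝ) * W.realPeriodRat = plusPeriod f → 0 ≤ padicValRat 2 ϖ)
    (hr : W.analyticRank = 0) (hmult : Mult W 2) (hns : ¬ W.HasSplitMultiplicativeReductionAtPrime 2)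
    (him : TwoAdicSurjective W) (hΔ : W.Δ < 0)
    (hlan : X2.AnalyticLambdaEq W 2 n) (hμan : X2.AnalyticMuLE W 2 0) : BSDp W 2 := by
  haveI : NeZero (W.conductorNorm ℤ) := ⟨(W.conductorNorm_pos_holds).ne'⟩
  obtain ⟨Dm⟩ := hmod W
  have hf : IsNewformOf W Dm.f := Dm.isNewformOf
  have hL : W.entireLFunction 1 ≠ 0 :=
    (W.analyticRank_eq_zero_iff_holds hf.hasEntireLFunction).mp hr
  obtain ⟨ϖ, -, hϖ, -⟩ := Dm.exists_rat_mul_realPeriodRat_eq_plusPeriod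
  obtain ⟨κ, hκ, γ, hγ, hγ'⟩ := exists_isCyclotomic_isTopGenerator_isCyclotomicVariable_holds 2
  obtain ⟨DW⟩ := W.nonempty_selmerDualData_holds κ γ hγ
  obtain ⟨L, hLf⟩ := exists_isMultPAdicLFunctionOf_neg_one_of_nonsplit hf hmult hns
  obtain ⟨L₀, hL₀⟩ := exists_iwasawaToPowerSeries_eq_C_mul_of_isMultPAdicLFunctionOf_neg_one_two hf
    hmult hns (hper₀ Dm.f hf ϖ hϖ) hLf
  obtain ⟨hX, hKL₀⟩ := hKint hmult hns him hΔ Dm.f hf L hLf κ γ hκ hγ hγ' DW ϖ hϖ L₀ hL₀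
  have hchar := charIdeal_eq_span_of_katoInt_selmerPinch_nonsplit W hns hlan hμan hκ hγ hγ' hf hLf DW
    hX hϖ hL₀ hKL₀ hlow
  exact bsdp_of_missingPPartAt W 2 hGZK (by rw [hr]; exact zero_le_one)
    (missingPPartAt_two_nonsplit_of_charIdeal_eq_span W
      (twoAdicEulerCharRankZeroNonsplitMult_zero_of_greenberg W h41) hGZK hmult hns hL hκ hγ hγ' hf hLf
      DW hX hϖ hL₀ hchar)

/-- **DOOR (34-INT-pinch), non-split `E` with `E[2]` irreducible, CONVERSE FORM (PROVED modulo the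
displayed inputs):** with the same inputs MINUS analytic rank `0` and GZK, `Sel_{2^∞}(E/ℚ)` finite
⇒ `L(E,1) ≠ 0 ∧ r_an(E) = 0`. [cite: GreenbergLNM1716, §4 pp. 112–113 and Prop. 4.14 (p. 124)]
[cite: MazurTateTeitelbaum1986Invent, §I.14] -/
theorem analyticRank_eq_zero_of_finite_selmer_of_katoIntPinch {n : ℕ}
    (h41 : thm41Analogue_charValue_rankZero_numberField_anyPrime)
    (hmod : nonempty_modularParametrizationData)
    (hKint : KatoDivisibilityAtTwoNonsplitMultInt W) (hlow : SelmerLambdaLowerBoundAtTwo W n)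
    (hper₀ : ∀ [NeZero (W.conductorNorm ℤ)] (f : CuspForm (Gamma0 (W.conductorNorm ℤ)) 2),
      IsNewformOf W f → ∀ ϖ : ℚ, (ϖ : ℝ) * W.realPeriodRat = plusPeriod f → 0 ≤ padicValRat 2 ϖ)
    (hmult : Mult W 2) (hns : ¬ W.HasSplitMultiplicativeReductionAtPrime 2)
    (him : TwoAdicSurjective W) (hΔ : W.Δ < 0)
    (hlan : X2.AnalyticLambdaEq W 2 n) (hμan : X2.AnalyticMuLE W 2 0)
    (hfin : Finite (W.selmerGroupPInfty 2)) : W.entireLFunction 1 ≠ 0 ∧ W.analyticRank = 0 := by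
  haveI : NeZero (W.conductorNorm ℤ) := ⟨(W.conductorNorm_pos_holds).ne'⟩
  obtain ⟨Dm⟩ := hmod W
  have hf : IsNewformOf W Dm.f := Dm.isNewformOf
  obtain ⟨ϖ, -, hϖ, -⟩ := Dm.exists_rat_mul_realPeriodRat_eq_plusPeriod
  obtain ⟨κ, hκ, γ, hγ, hγ'⟩ := exists_isCyclotomic_isTopGenerator_isCyclotomicVariable_holds 2
  obtain ⟨DW⟩ := W.nonempty_selmerDualData_holds κ γ hγ
  obtain ⟨L, hLf⟩ := exists_isMultPAdicLFunctionOf_neg_one_of_nonsplit hf hmult hns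
  obtain ⟨L₀, hL₀⟩ := exists_iwasawaToPowerSeries_eq_C_mul_of_isMultPAdicLFunctionOf_neg_one_two hf
    hmult hns (hper₀ Dm.f hf ϖ hϖ) hLf
  obtain ⟨hX, hKL₀⟩ := hKint hmult hns him hΔ Dm.f hf L hLf κ γ hκ hγ hγ' DW ϖ hϖ L₀ hL₀
  have hchar := charIdeal_eq_span_of_katoInt_selmerPinch_nonsplit W hns hlan hμan hκ hγ hγ' hf hLf DW
    hX hϖ hL₀ hKL₀ hlow
  exact entireLFunction_one_ne_zero_of_finite_selmer_of_charIdeal_eq_span_nonsplit W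
    (twoAdicEulerCharRankZeroNonsplitMult_zero_of_greenberg W h41) hmult hns hκ hγ hγ' hf hLf DW hX hL₀
    hchar hfin

/-! ## §4 The UPPER HALF alone (item `MultUpperHalfAtTwo`) from T-KATO2-NSMULT — no certificate at all -/

/-- **`MissingUpperBoundAt W 2` at a NON-SPLIT `2` for `E[2]` irreducible from T-KATO2-NSMULT ALONE
(PROVED modulo the displayed inputs; SHARP, no `λ`/`μ` certificate, no Selmer bound).** Rank `0` (`hr`),
`Mult W 2`, non-split, `TwoAdicSurjective W`, `Δ < 0`; PRINT {A235 `h41`, `hmod`, `hGZK`}; MEMO {`hKint`};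
the period datum `hper₀`. `hKint` gives `X` torsion and `L₀ ∈ char_Λ X` for `ι L₀ = ϖ·L`, and
`upperBound_two_nonsplit_of_divisibilityRat` (A235: `l_v = 2` cancels MTT's `2`) at `ϖ′ = ϖ`, `k = 0` gives
`ord₂ #Ш ≤ ord₂ #Ш_an`. This is the per-curve form of Theorem A's Corollary D(i) on the `Δ < 0` locus
(814 surjective non-split classes of record). [cite: GreenbergLNM1716, §4 pp. 112–113]
[cite: MazurTateTeitelbaum1986Invent, §I.10 and §I.14] [cite: Miller2011LMS, Def. 1.1] -/
theorem missingUpperBoundAt_two_nonsplit_of_katoInt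
    (h41 : thm41Analogue_charValue_rankZero_numberField_anyPrime)
    (hmod : nonempty_modularParametrizationData)
    (hGZK : rank_eq_analyticRank_of_analyticRank_le_one)
    (hKint : KatoDivisibilityAtTwoNonsplitMultInt W)
    (hper₀ : ∀ [NeZero (W.conductorNorm ℤ)] (f : CuspForm (Gamma0 (W.conductorNorm ℤ)) 2),
      IsNewformOf W f → ∀ ϖ : ℚ, (ϖ : ℝ) * W.realPeriodRat = plusPeriod f → 0 ≤ padicValRat 2 ϖ)
    (hr : W.analyticRank = 0) (hmult : Mult W 2) (hns : ¬ W.HasSplitMultiplicativeReductionAtPrime 2)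
    (him : TwoAdicSurjective W) (hΔ : W.Δ < 0) : MissingUpperBoundAt W 2 := by
  haveI : NeZero (W.conductorNorm ℤ) := ⟨(W.conductorNorm_pos_holds).ne'⟩
  obtain ⟨Dm⟩ := hmod W
  have hf : IsNewformOf W Dm.f := Dm.isNewformOf
  have hL : W.entireLFunction 1 ≠ 0 :=
    (W.analyticRank_eq_zero_iff_holds hf.hasEntireLFunction).mp hr
  obtain ⟨ϖ, hϖpos, hϖeq, -⟩ := Dm.exists_rat_mul_realPeriodRat_eq_plusPeriod
  obtain ⟨κ, hκ, γ, hγ, hγ'⟩ := exists_isCyclotomic_isTopGenerator_isCyclotomicVariable_holds 2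
  obtain ⟨D⟩ := W.nonempty_selmerDualData_holds κ γ hγ
  obtain ⟨L, hLf⟩ := exists_isMultPAdicLFunctionOf_neg_one_of_nonsplit hf hmult hns
  obtain ⟨L₀, hL₀⟩ := exists_iwasawaToPowerSeries_eq_C_mul_of_isMultPAdicLFunctionOf_neg_one_two hf
    hmult hns (hper₀ Dm.f hf ϖ hϖeq) hLf
  obtain ⟨hX, hmem⟩ := hKint hmult hns him hΔ Dm.f hf L hLf κ γ hκ hγ hγ' D ϖ hϖeq L₀ hL₀
  obtain ⟨q, hq, hle⟩ := upperBound_two_nonsplit_of_divisibilityRat W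
    (twoAdicEulerCharRankZeroNonsplitMult_zero_of_greenberg W h41) hGZK hmult hns hL hκ hγ hγ'
    hf hLf D ϖ hϖeq hϖpos.ne' 0 (by simp) ⟨hX, L₀, hmem, hL₀⟩
  exact ⟨q, hq, by simpa using hle⟩

end Summit.BirchSwinnertonDyer.Rank1Residual.X5.O1

end
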